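import Summits.AtomisticToContinuum.HydrodynamicLimit.Theses.CollisionIsometryCLT
import Summits.AtomisticToContinuum.HydrodynamicLimit.Theses.StiffCollisionalRelaxation
import Literature.Analysis.FluidPDE.HardSphereCollisionRecord
import Literature.MathematicalPhysics.KineticTheory.Hilbert6Wave0

/-!
# Line `pythagorean-mgf-transport` — skeleton for the crux `CollisionIsometryCLT.AprioriBounds`
(crux item stmt-AtomisticToContinuum-9519, rank 5; shared verbatim with `StiffCollisionalRelaxation.AprioriBounds`;
routes `route-AtomisticToContinuum-CollisionIsometryCLT`, `route-AtomisticToContinuum-StiffCollisionalRelaxation`)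

Crux (FIXED, by name): for all continuous positive profiles `∃ σ₀ ∀ σ < σ₀ ∀ Φ ∀ t > 0`:
(i) `∃ λ > 0, C` with `P_N{ C < ∫₀ᵗ (N+1)⁻¹ Σᵢ exp(λ |vᵢ(s)|²) ds } → 0`, and
(ii) for every admissible kernel family `∃ c₁ > 0` with `P_N{∃ s ≤ t ∃ x, ρ̄ < c₁ ∨ 1 < ρ̄ σ³} → 0`
(`P_N` the local Gibbs law, the gas evolved deterministically).

Idea (crux idea `pythagorean-mgf-transport`, ideator 2 gen 2; TRIAGE r1-1/2/3: pass ×3). THE LEVER: for an elastic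
collision with unit normal `ω`, `⟪a, v⁺⟫ = ⟪a − ⟪a,ω⟫ω, v⁻⟫ + ⟪a,ω⟫⟪w⁻,ω⟫` and `‖a‖² = ‖a − ⟪a,ω⟫ω‖² + ⟪a,ω⟫²`
(`chernoff_splitting`, `chernoff_pythagoras`, PROVED below): the Chernoff/Laplace vector of a Gaussian tail bound splits
ORTHOGONALLY at every collision, so a Gaussian moment-generating-function envelope `≲ e^{Θ‖a‖²/2}` of the velocities
ENTERING collisions reproduces its Gaussian exponent EXACTLY on the velocities LEAVING them; all slack sits in prefactors,
and the prefactor class `A R^{-p} e^{-εR}` is CONTRACTED by one collision above an explicit (astronomically large but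
`N`-uniform) level `R_e ~ S^{1/(p-1/2)}` whatever the constant slack `S` (chip-averaging contraction). Gaussianity of
what enters collisions therefore climbs from CONSTANT levels (stub 3) to ALL levels (the envelope, stub 4) for free,
given one-sided, cell-wise, in-expectation molecular chaos for INCOMING pairs (stub 1) and Enskog-order kinematics of
flights and collision counts (stub 2). The envelope at all levels, a tilted sojourn bound (stub 2 (f)) and a bounded
pair-decorrelation (stub 5) give component (i) by flight bookkeeping, uniform integrability at a doubled `λ`
("λ is a dial", honouring `Negative/AllLambda`) and Chebyshev (stub 6). Component (ii) is NOT this idea's business: it is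
imported as stub 7, the output of the (ii)-lines `commutator-matched-bootstrap` / `bootstrap-chamber-confinement`
(TRIAGE r1-2 G1/G3, r1-3 C0/C1/C3: "skeleton (i) and (ii) together").

Architecture = the idea card's engine + the `visit-ledger-upscattering` adapter + a variance supplement (TRIAGE r1-2
"compose", r1-3 "synthesis"); the alternative completion through `lambda-dial-superextensive-cap` (E1 equilibrium
super-exponential local-unit LD + E3-fine sandwich) is NOT used: both inputs have no producer on the board and E1 is
flagged "do not staff" (TRIAGE r1-3), while this completion consumes the envelope at ALL levels instead of only the cap.
The `√log N` speed cap (`SpeedCapSurgery.MaxSpeedBoundLog` at `(σ, Φ, t)`, stmt-9629) is a Markov/union-bound COROLLARY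
of `EnvelopeAt` (constant `C² = (8/3 + δ)Θ`); it is documented in the line card, not registered as a stub.

## Stubs (7, registered; D-0027 §3.3 shape: sorried theorems in `Holds`, their statements by name, `AprioriBounds_of`)
1. `stub_pairFactorisation` — OPEN, the chaos crux of the line: CELL-WISE ENSKOG DOMINATION OF INCOMING PAIRS, in
   expectation, one constant, all horizons `t' ≤ t` (flux weight dominated by `|v·ω| + |w·ω|`, product test functions).
2. `stub_flightsAndRates` — OPEN, kinematic Enskog statistics of mesoscopic cells: (b) flight locality (tilted),
   (c) collision-count floor from the initial layer on, (d) count ceiling, (e) adjacent-cell comparability,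
   (f) tilted sojourn bound (occupation ≤ Enskog flight time × flight supply).
3. `stub_inputShape` — OPEN: (a) sub-Gaussian SHAPE `Θ'` of the collision-input law at every CONSTANT level
   (`‖a‖ ≤ a*`, eventually in `N`, all horizons — the bulk/fixed-level hypothesis K3 of the card, `R_e` folded into `a*`);
   (b) the initial layer `t' ≤ κ (N+1)^{-1/3}` (a fraction of a mean free time) at ALL levels (Lanford window at fixed `σ`).
4. `stub_mgfTransport` — THE LEVER (deterministic given 1–3; XL): 1 ∧ 2 ∧ 3 ⇒ `EnvelopeAt`
   (`∃ Θ ∀ μ < 1/(2Θ): E Σ_records (e^{μ|v⁻|²} + e^{μ|v⁺|²}) ≤ C (N+1)^{4/3}`).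
5. `stub_pairDecorrelation` — OPEN (LLN class): bounded one-time observables of two tagged particles at two times
   decorrelate uniformly as `N → ∞`.
6. `stub_occupationLedger` — deterministic given its inputs (L): `EnvelopeAt ∧ 2 ∧ 5 ⇒ (i)` at `(σ, Φ, t)`.
7. `stub_chamberImport` — OPEN, NOT this idea's lever: `(ii)` at `(σ, Φ, t)` (the (ii)-lines' output).
`AprioriBounds_of (h1 : stub_…) … (h7 : stub_…) : …CollisionIsometryCLT.AprioriBounds` — quantifier logic, kernel-checked;
`AprioriBounds_of_stiff` — the same for the shared copy `…StiffCollisionalRelaxation.AprioriBounds` (by definitional unfolding).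

## Disproof / Negative lemmas honoured
`Cruxes/AprioriBounds/Disproof.lean` has no `_false_without_` theorem for (i). Honoured: `Negative/AllLambda`
(`aprioriBoundsI_allLambda_false_at_equilibrium`): `λ` is existential everywhere and stub 6 produces
`λ < 1/(4Θ(1+ε))`, `Θ > Θ' > θ_max`; `Negative/WithoutSmallSigma` (`aprioriBoundsII_false_without_small_sigma`) and
`BlockDensityAveraging` (`c₁ ≤ 1`, `σ₀ ≤ 1`): stub 7 keeps `∃ σ₀` and `∃ c₁` exactly as the crux; `CriticalMoment`,
`FlowInvariance`, `FccPacking`, `AdmissibleKernel` are tools, not constraints. Disproof §5 (SUBSTANTIVE THREAT, post-collapse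
Guderley focusing, `∀ t > 0`): stubs 3(a) (`Θ' > θ_max`), 2(c),(f) (density floor behind flights), 5 (self-averaging) and 7
inherit the crux's exposure verbatim and restrict verbatim under the repair C′ = Disproof §6 `AprioriBoundsRepaired`
(`t < T`); the composition is unchanged under C′. Negatives index (12): `EulerCharacteristics.ExpTailBudget` (stmt-14607,
`e^{-cN}` currency for a one-body tail) — no stub makes an exponential-in-`N` claim; 9236/9238 (sub-population quantifiers) —
not instantiated; junk pattern `LanfordEnvelope` (flow off `Φ.good`) — every functional here is integrated against
`localGibbsLaw ≪ liouville`.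
-/

set_option autoImplicit false

namespace Summit.AtomisticToContinuum.HydrodynamicLimit.Cruxes.AprioriBounds.PythagoreanMgfTransport

open scoped BigOperators Topology ENNReal NNReal InnerProductSpace Classical
open MeasureTheory Filter Set Metric

noncomputable section

/-! ## Vocabulary -/

/-- Macroscopic position space `𝕋³`. -/
abbrev T3 : Type := UnitAddTorus (Fin 3)

/-- Velocity space `ℝ³`. -/
abbrev V3 : Type := EuclideanSpace ℝ (Fin 3)

/-- Phase space of `N + 1` spheres on `𝕋³`. -/
abbrev Cfg (N : ℕ) : Type := Literature.Analysis.FluidPDE.Config (N + 1) (Fin 3) T3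

/-- Hard-sphere flows of `N + 1` spheres at reduced density `σ`. -/
abbrev Flow (σ : ℝ) (N : ℕ) : Type :=
  Literature.Analysis.FluidPDE.HardSphereFlow (Literature.Analysis.FluidPDE.Torus.geometry (Fin 3))
    (Literature.MathematicalPhysics.KineticTheory.hsDiameter σ N) (N + 1)

/-- Families of flows, one per `N` (the crux quantifies over these). -/
abbrev Flows (σ : ℝ) : Type := (N : ℕ) → Flow σ N

/-- Collision records of `N + 1` spheres on `𝕋³`. -/
abbrev Rec (N : ℕ) : Type := Literature.Analysis.FluidPDE.HardSphereCollisionRecord (Fin 3) T3 (N + 1)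

/-- Index of a mesoscopic cell (`Torus.coarseCell`). -/
abbrev Cell : Type := Fin 3 → ℤ

/-- The local Gibbs law `P_N` of the crux. -/
def law (σ : ℝ) (a₀ θ₀ : T3 → ℝ) (u₀ : T3 → V3) (N : ℕ) (Φ : Flow σ N) : Measure (Cfg N) :=
  Literature.MathematicalPhysics.KineticTheory.localGibbsLaw σ a₀ u₀ θ₀ N Φ

/-- Side of the mesoscopic cells: `1 / (2⌈(N+1)^{1/6}⌉) ≍ (N+1)^{-1/6}` — an EVEN number of cells per axis, so
that the `Torus.coarseCell` grid on the symmetric representative `(-1/2, 1/2]³` tiles `𝕋³` by full congruent cubes (no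
boundary slivers). Any exponent in `(0, 1/3)` would do: cells shrink (the within-cell temperature mixture factor tends
to `1`) and stay `≫` one mean free path `(N+1)^{-1/3}/σ²`. -/
def side (N : ℕ) : ℝ := (2 * (⌈((N : ℝ) + 1) ^ ((1 : ℝ) / 6)⌉₊ : ℝ))⁻¹

/-- The cell of a point of `𝕋³`. -/
def cellOf (N : ℕ) (x : T3) : Cell := Literature.Analysis.FluidPDE.Torus.coarseCell (side N) x

/-- The collision-frequency scale `(N+1)^{1/3}` (`ν_N = κ σ² (N+1)^{1/3}`; `σ` is fixed, constants absorb it). -/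
def nuN (N : ℕ) : ℝ := ((N : ℝ) + 1) ^ ((1 : ℝ) / 3)

/-- Direction of a vector (junk `0` at `0`, a null set): the uniform law on `S²` is realised below as the image of
Lebesgue measure on the unit ball, constants absorbed. -/
def dir (x : V3) : V3 := ‖x‖⁻¹ • x

/-- Continuous positive profiles (the crux's standing hypotheses on `(a₀, θ₀, u₀)`). -/
def NiceProfiles (a₀ θ₀ : T3 → ℝ) (u₀ : T3 → V3) : Prop :=
  Continuous a₀ ∧ Continuous θ₀ ∧ Continuous u₀ ∧ (∀ x, 0 < a₀ x) ∧ (∀ x, 0 < θ₀ x)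

/-! ### Expected collision intensities of a mesoscopic cell (first moments under `P_N`) -/

/-- **Tilted incoming one-body intensity** of cell `q` up to horizon `t'`:
`ψ_{q,t'}(h) = E_N Σ_{records c, time ∈ (0,t'], cell(x_fst) = q} h(v_fst⁻)` (both orderings of every collision are
records, so first-particle marginals suffice). -/
def inten (σ : ℝ) (a₀ θ₀ : T3 → ℝ) (u₀ : T3 → V3) (N : ℕ) (Φ : Flow σ N) (q : Cell) (t' : ℝ)
    (h : V3 → ℝ≥0∞) : ℝ≥0∞ :=
  ∫⁻ z, Φ.collisionSum (Ioc 0 t') (fun c : Rec N => if cellOf N c.fstPos = q then h c.preVel.1 else 0) z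
    ∂(law σ a₀ θ₀ u₀ N Φ)

/-- **Expected number of (ordered) collision records** of cell `q` up to horizon `t'`: `n_{q,t'} = ψ_{q,t'}(1)`. -/
def count (σ : ℝ) (a₀ θ₀ : T3 → ℝ) (u₀ : T3 → V3) (N : ℕ) (Φ : Flow σ N) (q : Cell) (t' : ℝ) : ℝ≥0∞ :=
  inten σ a₀ θ₀ u₀ N Φ q t' (fun _ => 1)

/-- **Incoming pair intensity** of cell `q` up to horizon `t'` tested against `F(ω, v⁻, w⁻)`
(impact vector and the two incoming velocities of each record). -/
def pairInten (σ : ℝ) (a₀ θ₀ : T3 → ℝ) (u₀ : T3 → V3) (N : ℕ) (Φ : Flow σ N) (q : Cell) (t' : ℝ)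
    (F : V3 → V3 → V3 → ℝ≥0∞) : ℝ≥0∞ :=
  ∫⁻ z, Φ.collisionSum (Ioc 0 t')
      (fun c : Rec N => if cellOf N c.fstPos = q then F c.impactVec c.preVel.1 c.preVel.2 else 0) z
    ∂(law σ a₀ θ₀ u₀ N Φ)

/-- **Expected initial particle number** of cell `q`: `m_q = E_N #{i : cell(xᵢ(0)) = q}` (static, `≍ (N+1)|Q| a₀`). -/
def mass (σ : ℝ) (a₀ θ₀ : T3 → ℝ) (u₀ : T3 → V3) (N : ℕ) (Φ : Flow σ N) (q : Cell) : ℝ≥0∞ :=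
  ∫⁻ z, ((Finset.univ.filter fun i : Fin (N + 1) => cellOf N (z i).1 = q).card : ℝ≥0∞) ∂(law σ a₀ θ₀ u₀ N Φ)

/-- **Far-flown incoming intensity** (tilted by `e^{⟪a, v⁻⟫}`): incoming records of cell `q` whose first particle
flew farther than one cell side since its previous collision (or since time `0`) — the predecessor may then lie outside
the 27-cell neighbourhood of `q` (the only leak of the cell-wise incoming ledger). -/
def farInten (σ : ℝ) (a₀ θ₀ : T3 → ℝ) (u₀ : T3 → V3) (N : ℕ) (Φ : Flow σ N) (q : Cell) (t' : ℝ) (a : V3) : ℝ≥0∞ :=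
  ∫⁻ z, Literature.Analysis.FluidPDE.collisionPairSum (Literature.Analysis.FluidPDE.Torus.geometry (Fin 3))
      (Literature.MathematicalPhysics.KineticTheory.hsDiameter σ N) (fun s => Φ.flow s z) (Ioc 0 t')
      (fun τ i j =>
        let c : Rec N := Literature.Analysis.FluidPDE.HardSphereCollisionRecord.ofConfig
          (Literature.Analysis.FluidPDE.Torus.geometry (Fin 3))
          (Literature.MathematicalPhysics.KineticTheory.hsDiameter σ N) (Φ.flow τ z) τ i j
        if cellOf N c.fstPos = q ∧
            side N < ‖c.preVel.1‖ * (τ - Literature.Analysis.FluidPDE.flightStart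
              (Literature.Analysis.FluidPDE.Torus.geometry (Fin 3))
              (Literature.MathematicalPhysics.KineticTheory.hsDiameter σ N) (fun s => Φ.flow s z) 0 i τ)
        then ENNReal.ofReal (Real.exp ⟪a, c.preVel.1⟫_ℝ) else 0)
    ∂(law σ a₀ θ₀ u₀ N Φ)

/-- **Expected time-occupation** of a velocity weight `w` on `[0, t]`: `E_N ∫₀ᵗ Σᵢ w(vᵢ(s)) ds`. -/
def occupation (σ : ℝ) (a₀ θ₀ : T3 → ℝ) (u₀ : T3 → V3) (N : ℕ) (Φ : Flow σ N) (t : ℝ) (w : V3 → ℝ≥0∞) : ℝ≥0∞ :=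
  ∫⁻ z, (∫⁻ s in Icc 0 t, ∑ i : Fin (N + 1), w (Φ.flow s z i).2) ∂(law σ a₀ θ₀ u₀ N Φ)

/-- **Flight supply** of a weight `w` on `[0, t]` at the Enskog flight time `∝ 1/(1 + |v|)`: every free flight
starts at time `0` or at a record (outgoing velocity of its first particle);
`E_N [Σᵢ w(vᵢ(0))/(1+|vᵢ(0)|) + Σ_records w(v_fst⁺)/(1+|v_fst⁺|)]`. -/
def flightSupply (σ : ℝ) (a₀ θ₀ : T3 → ℝ) (u₀ : T3 → V3) (N : ℕ) (Φ : Flow σ N) (t : ℝ) (w : V3 → ℝ≥0∞) : ℝ≥0∞ :=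
  ∫⁻ z, ((∑ i : Fin (N + 1), w (z i).2 * (ENNReal.ofReal (1 + ‖(z i).2‖))⁻¹) +
      Φ.collisionSum (Ioc 0 t) (fun c : Rec N => w c.postVel.1 * (ENNReal.ofReal (1 + ‖c.postVel.1‖))⁻¹) z)
    ∂(law σ a₀ θ₀ u₀ N Φ)

/-! ## The statements of the line (at fixed `σ`, profiles, flow family `Φ`, horizon `t`) -/

/-- **K1 — cell-wise Enskog domination of incoming pairs** (one-sided molecular chaos for what ENTERS collisions,
in expectation, ONE constant, every horizon `t' ∈ (0, t]`, eventually in `N`): for product test functions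
`f(ω,v) g(ω,w) ≥ 0` the incoming pair intensity of a cell is at most `S / n_{q,t'}` times the average over directions
`ω` of the flux-dominated pairing `ψ(|·ω| f(ω,·)) ψ(g(ω,·)) + ψ(f(ω,·)) ψ(|·ω| g(ω,·))` of the cell's OWN incoming
one-body intensities (hard-sphere flux `((v−w)·ω)₊ ≤ |v·ω| + |w·ω|`). At equilibrium this holds exactly in structure
(velocities Gaussian and independent of positions, incoming = half-space). -/
def PairFactorisationAt (σ : ℝ) (a₀ θ₀ : T3 → ℝ) (u₀ : T3 → V3) (Φ : Flows σ) (t : ℝ) : Prop :=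
  ∃ S : ℝ≥0∞, S ≠ ⊤ ∧ ∃ N₀ : ℕ, ∀ N : ℕ, N₀ ≤ N → ∀ q : Cell, ∀ t' ∈ Ioc 0 t,
    ∀ f g : V3 → V3 → ℝ≥0∞, Measurable (Function.uncurry f) → Measurable (Function.uncurry g) →
      pairInten σ a₀ θ₀ u₀ N (Φ N) q t' (fun ω v w => f ω v * g ω w) ≤
        S * (count σ a₀ θ₀ u₀ N (Φ N) q t')⁻¹ *
          ∫⁻ x in ball (0 : V3) 1,
            (inten σ a₀ θ₀ u₀ N (Φ N) q t' (fun v => ‖⟪v, dir x⟫_ℝ‖ₑ * f (dir x) v) *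
                inten σ a₀ θ₀ u₀ N (Φ N) q t' (g (dir x)) +
              inten σ a₀ θ₀ u₀ N (Φ N) q t' (f (dir x)) *
                inten σ a₀ θ₀ u₀ N (Φ N) q t' (fun w => ‖⟪w, dir x⟫_ℝ‖ₑ * g (dir x) w))

/-- **Kinematic Enskog statistics of flights and collision counts** (one constant `C`, eventually in `N`):
(b) FLIGHT LOCALITY — for every tilt `e^{⟪a,·⟫}`, at most half of the tilted incoming intensity of a cell comes from
records whose particle flew farther than one cell side `(N+1)^{-1/6}` (`≫` mean free path) since its last collision;
(d) COUNT CEILING — `n_{q,t} ≤ C (N+1)^{1/3} m_q` (Enskog-order collision frequency, needs bounded contact value: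
the dilute chamber of (ii) is silently behind it);
(e) ADJACENT COMPARABILITY — neighbouring cells have comparable counts at every horizon;
(f) TILTED SOJOURN — for every weight `w ≥ 0`, `E ∫₀ᵗ Σᵢ w(vᵢ(s)) ds ≤ C (N+1)^{-1/3} × flight supply of w`
(flights after records / after time `0` last at most `C ×` the Enskog free time `∝ (N+1)^{-1/3}/(1+|v|)` in `w`-tilted
mean: NO CHANNELLING of fast spheres; a density floor is silently behind it);
(c) COUNT FLOOR — for every `κ > 0`, from the edge `κ (N+1)^{-1/3}` of the initial layer on, `m_q ≤ C_κ n_{q,t'}`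
(every cell has produced `≳ κ` records per initial particle after `κ` mean free times). -/
def FlightsAndRatesAt (σ : ℝ) (a₀ θ₀ : T3 → ℝ) (u₀ : T3 → V3) (Φ : Flows σ) (t : ℝ) : Prop :=
  (∃ C : ℝ≥0∞, C ≠ ⊤ ∧ ∃ N₀ : ℕ, ∀ N : ℕ, N₀ ≤ N →
    (∀ q : Cell, ∀ t' ∈ Ioc 0 t, ∀ a : V3,
        farInten σ a₀ θ₀ u₀ N (Φ N) q t' a ≤
          2⁻¹ * inten σ a₀ θ₀ u₀ N (Φ N) q t' (fun v => ENNReal.ofReal (Real.exp ⟪a, v⟫_ℝ))) ∧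
    (∀ q : Cell, count σ a₀ θ₀ u₀ N (Φ N) q t ≤ C * ENNReal.ofReal (nuN N) * mass σ a₀ θ₀ u₀ N (Φ N) q) ∧
    (∀ q q' : Cell, ∀ t' ∈ Ioc 0 t,
        (∃ x x' : T3, cellOf N x = q ∧ cellOf N x' = q' ∧
            Literature.Analysis.FluidPDE.Torus.euclidDist x x' ≤ side N) →
          count σ a₀ θ₀ u₀ N (Φ N) q' t' ≤ C * count σ a₀ θ₀ u₀ N (Φ N) q t') ∧
    (∀ w : V3 → ℝ≥0∞, Measurable w →
        occupation σ a₀ θ₀ u₀ N (Φ N) t w ≤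
          C * (ENNReal.ofReal (nuN N))⁻¹ * flightSupply σ a₀ θ₀ u₀ N (Φ N) t w)) ∧
  (∀ κ : ℝ, 0 < κ → ∃ Cκ : ℝ≥0∞, Cκ ≠ ⊤ ∧ ∃ N₀ : ℕ, ∀ N : ℕ, N₀ ≤ N → ∀ q : Cell,
      ∀ t' ∈ Icc (κ * (nuN N)⁻¹) t, mass σ a₀ θ₀ u₀ N (Φ N) q ≤ Cκ * count σ a₀ θ₀ u₀ N (Φ N) q t')

/-- **Shape of the collision-input law where the transport does not act.**
(a) CONSTANT LEVELS, ALL HORIZONS (the card's K3, with the astronomical contraction threshold `R_e` folded into the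
bounded range `‖a‖ ≤ a*`: for EVERY `a*`, eventually in `N`): the mgf of the incoming one-body law of every cell is
sub-Gaussian with ONE variance proxy `Θ'` and ONE constant `C₀`, `ψ_{q,t'}(e^{⟪a,·⟫}) ≤ C₀ e^{Θ'‖a‖²/2} n_{q,t'}`.
This is `N`-uniform exponential-moment information of BOUNDED order about the evolved gas — not the envelope (which is
uniform in `a` up to `‖a‖² ≍ log N`); it carries the HOT-SPOT exposure (`Θ'` must exceed every temperature reached on
`[0,t]`, Disproof §4d/§5).
(b) THE INITIAL LAYER, ALL LEVELS: during the first `κ` mean free times the incoming law is flux-tilted sub-Gaussian at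
every level — the Lanford/Cauchy–Kovalevskaya window at fixed `σ` (GST2013 Ch. 5 a priori bounds depend only on
`t' ν_N ≤ κ`), provable in principle; it anchors the horizon-continuity argument of the transport. -/
def InputShapeAt (σ : ℝ) (a₀ θ₀ : T3 → ℝ) (u₀ : T3 → V3) (Φ : Flows σ) (t : ℝ) : Prop :=
  ∃ Θ' C₀ κ : ℝ, 0 < Θ' ∧ 0 < κ ∧
    (∀ astar : ℝ, ∃ N₀ : ℕ, ∀ N : ℕ, N₀ ≤ N → ∀ q : Cell, ∀ t' ∈ Ioc 0 t, ∀ a : V3, ‖a‖ ≤ astar →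
        inten σ a₀ θ₀ u₀ N (Φ N) q t' (fun v => ENNReal.ofReal (Real.exp ⟪a, v⟫_ℝ)) ≤
          ENNReal.ofReal (C₀ * Real.exp (Θ' * ‖a‖ ^ 2 / 2)) * count σ a₀ θ₀ u₀ N (Φ N) q t') ∧
    (∃ N₀ : ℕ, ∀ N : ℕ, N₀ ≤ N → ∀ q : Cell, ∀ t' ∈ Ioc 0 (κ * (nuN N)⁻¹), ∀ a : V3,
        inten σ a₀ θ₀ u₀ N (Φ N) q t' (fun v => ENNReal.ofReal (Real.exp ⟪a, v⟫_ℝ)) ≤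
          ENNReal.ofReal (C₀ * (1 + ‖a‖) * Real.exp (Θ' * ‖a‖ ^ 2 / 2)) * count σ a₀ θ₀ u₀ N (Φ N) q t')

/-- **The line's output: a Gaussian envelope of what enters and leaves collisions, in expectation, at every level.**
For some proxy `Θ > 0`, every rate `μ < 1/(2Θ)` and all large `N`:
`E_N Σ_{records in (0,t]} (e^{μ|v_fst⁻|²} + e^{μ|v_fst⁺|²}) ≤ C (N+1)^{4/3}` (`(N+1)^{4/3} ≍ (N+1) ν_N t / σ²` records).
By Chernoff this is the card's `GaussianInputEnvelope` (`E #{records with energy > R} ≤ K (N+1)^{4/3} e^{-μR}`). -/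
def EnvelopeAt (σ : ℝ) (a₀ θ₀ : T3 → ℝ) (u₀ : T3 → V3) (Φ : Flows σ) (t : ℝ) : Prop :=
  ∃ Θ : ℝ, 0 < Θ ∧ ∀ μ : ℝ, 0 < μ → μ < 1 / (2 * Θ) → ∃ C : ℝ, ∃ N₀ : ℕ, ∀ N : ℕ, N₀ ≤ N →
    ∫⁻ z, (Φ N).collisionSum (Ioc 0 t)
        (fun c : Rec N => ENNReal.ofReal (Real.exp (μ * ‖c.preVel.1‖ ^ 2)) +
          ENNReal.ofReal (Real.exp (μ * ‖c.postVel.1‖ ^ 2))) z ∂(law σ a₀ θ₀ u₀ N (Φ N)) ≤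
      ENNReal.ofReal (C * ((N : ℝ) + 1) ^ ((4 : ℝ) / 3))

/-- The `√log N` speed cap at `(σ, t, Φ)` — the body of `SpeedCapSurgery.MaxSpeedBoundLog` (stmt-9629) after its
profile/`σ` prefix. NOT a stub of this line: it is a COROLLARY of `EnvelopeAt` (Markov + union bound: speeds change only
at collisions and `‖v⁺‖² ≤ ‖v⁻‖² + ‖w⁻‖²`, `post_sq_le_pair_energy`;
`P(∃ r ≤ t ∃ i, |vᵢ(r)|² > L) ≤ C'(N+1) e^{-L/(2θ_max)} + C (N+1)^{4/3} e^{-μL} → 0` at `L = (4/3 + δ) μ⁻¹ log(N+2)`,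
i.e. cap constant `C_cap² ↓ (8/3 + δ')Θ` as `μ ↑ 1/(2Θ)`, the card's `EnvelopeGivesCap` calibration), recorded here for
the seats that dock on E4 (`lambda-dial-superextensive-cap`, `visit-ledger-upscattering` (U), route SpeedCapSurgery). -/
def CapAt (σ : ℝ) (a₀ θ₀ : T3 → ℝ) (u₀ : T3 → V3) (Φ : Flows σ) (t : ℝ) : Prop :=
  ∃ C : ℝ, Tendsto (fun N : ℕ => law σ a₀ θ₀ u₀ N (Φ N)
    {z | ∃ r ∈ Icc 0 t, ∃ i, C * Real.sqrt (Real.log ((N : ℝ) + 2)) < ‖((Φ N).flow r z i).2‖}) atTop (𝓝 0)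

/-- **Bounded pair decorrelation** (LLN class; the concentration supplement): the laws of the velocities of two
distinct tagged particles at two times in `[0, t]` decorrelate, uniformly over pairs, times and `[0,1]`-valued
observables, at some rate `δ_N → 0`. -/
def PairDecorrelationAt (σ : ℝ) (a₀ θ₀ : T3 → ℝ) (u₀ : T3 → V3) (Φ : Flows σ) (t : ℝ) : Prop :=
  ∃ δ : ℕ → ℝ, Tendsto δ atTop (𝓝 0) ∧ ∀ (N : ℕ) (i j : Fin (N + 1)), i ≠ j →
    ∀ s ∈ Icc 0 t, ∀ s' ∈ Icc 0 t, ∀ h₁ h₂ : V3 → ℝ, Measurable h₁ → Measurable h₂ →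
      (∀ v, h₁ v ∈ Icc (0 : ℝ) 1) → (∀ v, h₂ v ∈ Icc (0 : ℝ) 1) →
        |(∫ z, h₁ ((Φ N).flow s z i).2 * h₂ ((Φ N).flow s' z j).2 ∂(law σ a₀ θ₀ u₀ N (Φ N))) -
            (∫ z, h₁ ((Φ N).flow s z i).2 ∂(law σ a₀ θ₀ u₀ N (Φ N))) *
              (∫ z, h₂ ((Φ N).flow s' z j).2 ∂(law σ a₀ θ₀ u₀ N (Φ N)))| ≤ δ N

/-- Component **(i)** of the crux at `(σ, profiles, Φ, t)` — VERBATIM the first conjunct of `AprioriBounds` after its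
`∀ t, 0 < t →`. -/
def PartIAt (σ : ℝ) (a₀ θ₀ : T3 → ℝ) (u₀ : T3 → V3) (Φ : Flows σ) (t : ℝ) : Prop :=
  ∃ lam Cexp : ℝ, 0 < lam ∧ Tendsto (fun N : ℕ => Literature.MathematicalPhysics.KineticTheory.localGibbsLaw σ a₀ u₀ θ₀ N (Φ N) {z | Cexp < ∫ s in Icc 0 t, ∫ y, Real.exp (lam * ‖y.2‖ ^ 2) ∂(Literature.Analysis.FluidPDE.empiricalMeasure ((Φ N).flow s z))}) atTop (𝓝 0)

/-- Component **(ii)** of the crux at `(σ, profiles, Φ, t)` — VERBATIM the second conjunct of `AprioriBounds`. -/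
def PartIIAt (σ : ℝ) (a₀ θ₀ : T3 → ℝ) (u₀ : T3 → V3) (Φ : Flows σ) (t : ℝ) : Prop :=
  ∀ (γ C : ℝ) (φ : ℕ → (UnitAddTorus (Fin 3)) → ℝ), 0 < γ → γ ≤ 1 / 15 → ((∀ N, Literature.Analysis.FunctionSpaces.Torus.IsSmooth (φ N)) ∧ (∀ N y, 0 ≤ φ N y) ∧ (∀ N, ∫ y, φ N y = 1) ∧ (∀ (N : ℕ) y, ((N : ℝ) + 1) ^ (-γ) ≤ Literature.Analysis.FluidPDE.Torus.euclidDist y 0 → φ N y = 0) ∧ (∀ (N : ℕ) y, φ N y ≤ C * ((N : ℝ) + 1) ^ (3 * γ)) ∧ (∀ (N : ℕ) y, ‖Literature.Analysis.FunctionSpaces.Torus.gradient (φ N) y‖ ≤ C * ((N : ℝ) + 1) ^ (4 * γ))) → ∃ c₁ : ℝ, 0 < c₁ ∧ Tendsto (fun N : ℕ => Literature.MathematicalPhysics.KineticTheory.localGibbsLaw σ a₀ u₀ θ₀ N (Φ N) {z | ∃ s ∈ Icc 0 t, ∃ x : (UnitAddTorus (Fin 3)), Literature.MathematicalPhysics.KineticTheory.empiricalDensityField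 ((Φ N).flow s z) (fun y => φ N (y - x)) < c₁ ∨ 1 < Literature.MathematicalPhysics.KineticTheory.empiricalDensityField ((Φ N).flow s z) (fun y => φ N (y - x)) * σ ^ 3}) atTop (𝓝 0)

/-- Sanity (pure logic): the crux IS `∀ profiles ∃ σ₀ ∀ σ < σ₀ ∀ Φ ∀ t > 0, PartIAt ∧ PartIIAt` — the two `At`
predicates are the crux's conjuncts verbatim. -/
theorem aprioriBounds_iff :
    Summit.AtomisticToContinuum.HydrodynamicLimit.Theses.CollisionIsometryCLT.AprioriBounds ↔
      ∀ (a₀ θ₀ : T3 → ℝ) (u₀ : T3 → V3), Continuous a₀ → Continuous θ₀ → Continuous u₀ →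
        (∀ x, 0 < a₀ x) → (∀ x, 0 < θ₀ x) → ∃ σ₀ : ℝ, 0 < σ₀ ∧ ∀ σ : ℝ, 0 < σ → σ < σ₀ →
          ∀ (Φ : Flows σ) (t : ℝ), 0 < t → PartIAt σ a₀ θ₀ u₀ Φ t ∧ PartIIAt σ a₀ θ₀ u₀ Φ t :=
  Iff.rfl

/-! ## Proved glue: the lever's identities (from the idea's `IdeatorTwoTransportSketch.lean`, re-checked here) -/

section Algebra

variable {E : Type*} [NormedAddCommGroup E] [InnerProductSpace ℝ E]

open Literature.MathematicalPhysics.KineticTheory in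
/-- **Chernoff splitting (one collision).** For the elastic law `collide ω (v, w)` and any test vector `a`:
`⟪a, v⁺⟫ = ⟪a − ⟪a,ω⟫ω, v⟫ + ⟪a,ω⟫·⟪w,ω⟫`. [folklore; Bobylev's Fourier-variable splitting read for the mgf] -/
theorem chernoff_splitting (ω : sphere (0 : E) 1) (p : E × E) (a : E) :
    ⟪a, (collide ω p).1⟫_ℝ =
      ⟪a - ⟪a, (ω : E)⟫_ℝ • (ω : E), p.1⟫_ℝ + ⟪a, (ω : E)⟫_ℝ * ⟪p.2, (ω : E)⟫_ℝ := by
  simp only [collide, inner_sub_right, real_inner_smul_right, inner_sub_left, real_inner_smul_left,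
    real_inner_comm (ω : E)]
  ring

/-- **Pythagoras for the Chernoff vector.** `‖a‖² = ‖a − ⟪a,ω⟫ω‖² + ⟪a,ω⟫²` for a unit `ω`: the Gaussian budget
`Θ‖a‖²/2` splits EXACTLY between the own factor and the partner factor. [folklore] -/
theorem chernoff_pythagoras (ω : sphere (0 : E) 1) (a : E) :
    ‖a‖ ^ 2 = ‖a - ⟪a, (ω : E)⟫_ℝ • (ω : E)‖ ^ 2 + ⟪a, (ω : E)⟫_ℝ ^ 2 := by
  have hω : ‖(ω : E)‖ = 1 := norm_eq_of_mem_sphere ω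
  have h1 : ‖a - ⟪a, (ω : E)⟫_ℝ • (ω : E)‖ ^ 2 =
      ‖a‖ ^ 2 - 2 * ⟪a, ⟪a, (ω : E)⟫_ℝ • (ω : E)⟫_ℝ + ‖⟪a, (ω : E)⟫_ℝ • (ω : E)‖ ^ 2 :=
    norm_sub_sq_real _ _
  have h2 : ⟪a, ⟪a, (ω : E)⟫_ℝ • (ω : E)⟫_ℝ = ⟪a, (ω : E)⟫_ℝ * ⟪a, (ω : E)⟫_ℝ :=
    real_inner_smul_right _ _ _
  have h3 : ‖⟪a, (ω : E)⟫_ℝ • (ω : E)‖ = |⟪a, (ω : E)⟫_ℝ| := by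
    rw [norm_smul, hω, mul_one, Real.norm_eq_abs]
  rw [h1, h2, h3, sq_abs]
  ring

open Literature.MathematicalPhysics.KineticTheory in
/-- `‖v⁺‖² ≤ ‖v‖² + ‖w‖²`: speeds above a level are CREATED only by records whose incoming pair energy exceeds it
(the union bound behind the `√log N` cap corollary of `EnvelopeAt`). [folklore] -/
theorem post_sq_le_pair_energy (ω : sphere (0 : E) 1) (p : E × E) :
    ‖(collide ω p).1‖ ^ 2 ≤ ‖p.1‖ ^ 2 + ‖p.2‖ ^ 2 := by
  have h := norm_sq_collide_fst_add_norm_sq_collide_snd ω p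
  nlinarith [sq_nonneg ‖(collide ω p).2‖]

end Algebra

/-! ## Registered stubs -/

namespace Holds

/-- STUB 1 — OPEN, THE CHAOS CRUX OF THE LINE (rank-2 analogue; size L as a statement, open as mathematics).
**Cell-wise Enskog domination of incoming pairs, in expectation.** For continuous positive profiles there is `σ₀ > 0`
such that for `0 < σ < σ₀`, every flow family and every `t > 0`, `PairFactorisationAt σ a₀ θ₀ u₀ Φ t`.
Why plausible: at equilibrium exact in structure (Gibbs factorises velocities from positions; incoming = half-space
restriction; one constant from `⟨ḡ⟩/ḡ_min²`); the statement is one-sided (UPPER bound), constant-factor, first-moment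
(granularity-safe, TRIAGE r1-1 cross-cutting), and cell-wise (the GLOBAL pairing `SpeedCapSurgery.ContactIntensityDomination`,
stmt-4604, is off by `λ⁶` at level `λ²` at a temperature maximum — mixture of products vs product of mixtures — and is
NOT used). Why it might fail: tail clustering beyond Gaussian multiplicativity (recollision loops at fixed `σ` are a
relative `O(σ³)` only if tails are already Gaussian — self-consistency, not a proof); hot filaments thinner than a cell;
contact value unbounded near jamming ((ii)'s chamber is silently behind the constant). Sources: idea card K1;
GambaPanferovVillani2009 (arXiv:math/0701081, Thm 3, Lemma 12: the pointwise dual at Boltzmann level);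
CIP1994 §2; kit falsifier (c) of the card (per-cell `S₁(E₁,E₂)` histogram). -/
theorem stub_pairFactorisation :
    ∀ (a₀ θ₀ : T3 → ℝ) (u₀ : T3 → V3), NiceProfiles a₀ θ₀ u₀ →
      ∃ σ₀ : ℝ, 0 < σ₀ ∧ ∀ σ : ℝ, 0 < σ → σ < σ₀ → ∀ (Φ : Flows σ) (t : ℝ), 0 < t →
        PairFactorisationAt σ a₀ θ₀ u₀ Φ t := by
  sorry

/-- STUB 2 — OPEN (kinematic Enskog statistics; size L; milder than stub 1 but of the same one-sided first-moment
class). **Flights are short and collision counts are Enskog-order, cell by cell.** For continuous positive profiles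
there is `σ₀ > 0` such that for `0 < σ < σ₀`, every flow family and every `t > 0`, `FlightsAndRatesAt σ a₀ θ₀ u₀ Φ t`.
Clause (f) is the `visit-ledger-upscattering` input (R) in its in-expectation, arbitrary-weight form (flights tile
`[0,t]`: `∫₀ᵗ Σᵢ w(vᵢ(s)) ds = Σ_flights w(v_flight)·duration`, gen-1 `IdeatorTwo.VelocityTelescoping` / ideator 1's
`VisitLedger` bookkeeping, provable); (b) is the card's K1b; (c),(d),(e) make the expected collision-count field of the
cells Enskog-order (two-sided) and smooth. Why it might fail: CHANNELLING — fast spheres in comoving streams or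
rarefied corridors fly anomalously long (kills (b),(f) in the tilted mean; the sub-extensive input every (i)-line
carries, IdeatorTwoBarrierNotes B2); near-vacuum cells ((ii)'s floor behind (c),(f)); contact-value blow-up near jamming
((ii)'s chamber behind (d)); all post-collapse for focusing profiles (Disproof §5). Sources: idea cards
`visit-ledger-upscattering` ((R), kit j009532/j009539), `stiff-localised-povzner` (H1), `pythagorean-mgf-transport` (K1b);
CIP1994 §2 (free-flight law); TRIAGE r1-2 §B. -/
theorem stub_flightsAndRates :
    ∀ (a₀ θ₀ : T3 → ℝ) (u₀ : T3 → V3), NiceProfiles a₀ θ₀ u₀ →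
      ∃ σ₀ : ℝ, 0 < σ₀ ∧ ∀ σ : ℝ, 0 < σ → σ < σ₀ → ∀ (Φ : Flows σ) (t : ℝ), 0 < t →
        FlightsAndRatesAt σ a₀ θ₀ u₀ Φ t := by
  sorry

/-- STUB 3 — OPEN for clause (a), provable in principle for clause (b) (size L–XL).
**Shape of the collision-input law at constant levels (all horizons) and in the initial layer (all levels).**
For continuous positive profiles there is `σ₀ > 0` such that for `0 < σ < σ₀`, every flow family and every `t > 0`,
`InputShapeAt σ a₀ θ₀ u₀ Φ t`. Clause (a) is the card's K3 made `N`-asymptotic at EVERY bounded order (TRIAGE r1-1/2/3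
sharpening: the contraction threshold `R_e ≈ 10⁴–10¹³ Θ` is astronomical, so "constant level" must mean "every fixed
level, eventually in `N`", which is strictly weaker than the envelope and does not give it by Chernoff); clause (b) is a
Lanford-window statement at fixed `σ` (times `≤ κ` mean free times; GST2013 Ch. 5 continuity estimates hold for every
`N, ε` in units of the mean free time). Why it might fail: (a) IS bulk-to-fixed-deep-tail shape information on the
evolved non-equilibrium law and carries the hot-spot input (`Θ'` above every temperature reached on `[0,t]`, Disproof
§4d message; false past a focusing collapse, §5); kinetic GENERATION of exponential moments reaches only orders `O(1)` in
thermal units, so (a) at the needed `a* = √R_e/Θ` is propagation-type (data-dependent) information (TRIAGE r1-2).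
Sources: idea card K3; GambaPanferovVillani2009 Thm 3 (rate loss `a < a₁`, not order loss — same signature);
GallagherSaintRaymondTexier2013 Ch. 5 (held paper:arxiv-1208.5753); Disproof §4d. -/
theorem stub_inputShape :
    ∀ (a₀ θ₀ : T3 → ℝ) (u₀ : T3 → V3), NiceProfiles a₀ θ₀ u₀ →
      ∃ σ₀ : ℝ, 0 < σ₀ ∧ ∀ σ : ℝ, 0 < σ → σ < σ₀ → ∀ (Φ : Flows σ) (t : ℝ), 0 < t →
        InputShapeAt σ a₀ θ₀ u₀ Φ t := by
  sorry

/-- STUB 4 — THE LEVER, LOAD-BEARING THEOREM OF THE LINE (deterministic given its hypotheses; size XL in Lean).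
**Pythagorean mgf transport: chaos for incoming pairs + Enskog kinematics + constant-level shape ⇒ the Gaussian
envelope at every level.** Proof plan (all pieces provable; none is an item):
(1) CHERNOFF SPLIT + PYTHAGORAS (`chernoff_splitting`, `chernoff_pythagoras`, proved above): the outgoing tilted
intensity `φ_{q,t'}(a) = E Σ e^{⟪P_ω a, v⁻⟫} e^{⟪a,ω⟩⟨w⁻,ω⟩}` is a product test function of the incoming pair;
(2) stub 1 bounds it by `S/n_q` times direction-averaged flux-tilted products of the cell's incoming intensities;
(3) TILT BY ENVELOPE (`|y| ≤ (e^{δy} + e^{-δy})/(eδ)`, `δ = 1/(Θ√(uR))`: a flux weight costs the envelope only a level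
shift `≤ 3` and the factor `√(uR)`) and the law `du/(2√u)` of `u = cos²∠(a,ω)` under uniform `ω` turn (2) into
`φ_q(a) ≤ n_q Λ² S' · T[B̄](R) · e^{R/2Θ}`, `R = Θ²‖a‖²`, for any envelope `ψ_q(b) ≤ n_q Λ B̄(Θ²‖b‖²) e^{Θ‖b‖²/2}`;
(4) CHIP-AVERAGING CONTRACTION (pure real analysis, card + TRIAGE r1-1 §E(3)/r1-2 §E/r1-3: for
`B̄(r) = B_b (r < R_b), A r^{-p} e^{-εr} (r ≥ R_b)`, `p ∈ (1/2,1)`, every slack `S'`: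
`S'·∫₀¹ (1+√(uR/Θ)) B̄(uR ± 3) B̄((1−u)R + 1) du/(2√u) ≤ B̄(R)/4` for `R ≥ R_e(S', Θ, p, ε, A, B_b, R_b)` explicit,
`R_e ~ S'^{1/(p−1/2)}`; the slack `S' = 2·27·C_adj·S·e^{O(1)}` absorbs stub 1's constant, the 27 neighbours of the
ledger (TRIAGE r1-3 sharpen (1): locality leak folded into `S`) and stub 2 (e));
(5) CELL-WISE INCOMING LEDGER (pathwise injection "incoming velocity = same sphere's previous outgoing velocity or its
initial velocity", the card's `IncomingLedger`, provable from `IsHardSphereTrajectory`; with stub 2 (b)):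
`ψ_q ≤ 2[Σ_{q'∼q} φ_{q'} + E Σ_{i ∈ nbhd(q)} e^{⟪a, vᵢ(0)⟫}]`, the last term an explicit Gaussian of the local
Gibbs data (`θ₀ ≤ θ_max < Θ' < Θ`, velocities Gaussian given positions) `≤ 27² C m_q e^{θ_max‖a‖²/2 + U‖a‖}`;
(6) HORIZON CONTINUITY: `Λ(t') := sup_{q,a} ψ_{q,t'}(a) / (n_{q,t'} B̄(R) e^{R/2Θ})` is `≤ 1/2` on the initial layer
`(0, κ/ν_N]` by stub 3 (b) (anchor), continuous on `[κ/ν_N, t]` for FIXED `N` (finitely many records with Gaussian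
moments: Burago–Ferleger–Kononenko uniform collision bound, doi:10.2307/120962 Thm 1, to be filed as a Literature fact;
absolute continuity of collision-time laws), and `Λ ≤ 1 ⇒ Λ ≤ 3/4` there: levels `≤ R_e` by stub 3 (a) with
`a* = √R_e/Θ` and `N ≥ N₀(a*)` (`B_b ≥ 2C₀`, `A ≥ 2C₀ (p/(e(δ−ε)))^p`, `δ = (Θ−Θ')/(2Θ²) > ε`), levels `> R_e` by
(3)+(4)+(5) with stub 2 (c) (`m_q ≤ C_κ n_{q,t'}` kills the initial term: `27² C C_κ e^{-δ'R} R^p e^{εR}/A ≤ 1/8` for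
`R ≥ R_e`); hence `Λ ≤ 3/4` on `(0, t]`;
(7) OUTPUT: Gaussian averaging in `a` (`E_{a∼N(0,2μ)} e^{⟪a,v⟫} = e^{μ|v|²}`, `μ < 1/(2Θ)`) of the `ψ` and `φ`
envelopes at horizon `t`, summed over cells with stub 2 (d) (`Σ_q n_{q,t} ≤ C ν_N Σ_q m_q = C (N+1)^{4/3}`).
Honest scope: constants are `N`-uniform but numerically astronomical (`R_e ≥ 10⁴ Θ` already at zero slack,
TRIAGE r1-2 table): a LIMIT theorem. -/
theorem stub_mgfTransport :
    ∀ (σ : ℝ) (a₀ θ₀ : T3 → ℝ) (u₀ : T3 → V3) (Φ : Flows σ) (t : ℝ), 0 < σ → σ < 1 / 2 → 0 < t →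
      NiceProfiles a₀ θ₀ u₀ →
      PairFactorisationAt σ a₀ θ₀ u₀ Φ t → FlightsAndRatesAt σ a₀ θ₀ u₀ Φ t → InputShapeAt σ a₀ θ₀ u₀ Φ t →
        EnvelopeAt σ a₀ θ₀ u₀ Φ t := by
  sorry

/-- STUB 5 — OPEN (LLN class; size M as a statement). **Bounded pair decorrelation along the evolved law.**
For continuous positive profiles there is `σ₀ > 0` such that for `0 < σ < σ₀`, every flow family and every `t > 0`,
`PairDecorrelationAt σ a₀ θ₀ u₀ Φ t`. At `s = s' = 0` it is the asymptotic independence of two tagged particles under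
the hard-core local Gibbs law (pair correlation volume `O(σ³/N)`); for later times it is propagation of chaos for ONE
bounded one-time observable of each of two tagged spheres — the self-averaging of one-body velocity statistics that
turns the in-expectation output of stubs 4/2 into (i)'s deterministic constant (IdeatorTwoBarrierNotes B6: tightness ≠
`∃ C`, TRIAGE r1-2 on visit-ledger: "needs a variance/concentration supplement"). Why it might fail: a RANDOM
MACROSTATE — instabilities amplifying thermal fluctuations to order one, or non-unique continuation past the first
singularity (the crux's `∀ t > 0` exposure again); catalogued class `MacroErgodicityHypothesisBarrier` /
`BoltzmannHypothesisBarrier` (no impossibility in print). Sources: Spohn1991 Part II (held book), KipnisLandim1999 (held),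
Disproof §5; route item `MesoscopicLLN` (stmt-9524) is its static `t = 0` shadow. -/
theorem stub_pairDecorrelation :
    ∀ (a₀ θ₀ : T3 → ℝ) (u₀ : T3 → V3), NiceProfiles a₀ θ₀ u₀ →
      ∃ σ₀ : ℝ, 0 < σ₀ ∧ ∀ σ : ℝ, 0 < σ → σ < σ₀ → ∀ (Φ : Flows σ) (t : ℝ), 0 < t →
        PairDecorrelationAt σ a₀ θ₀ u₀ Φ t := by
  sorry

/-- STUB 6 — deterministic given its inputs (size L in Lean). **Occupation ledger: envelope + tilted sojourn +
pair decorrelation ⇒ (i).** Proof plan: (1) flights tile `[0,t]`, so stub 2 (f) with `w = e^{μ|·|²}` gives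
`E X_N(μ) ≤ C ν_N⁻¹ (N+1)⁻¹ [ (N+1)·Gauss_{θ_max}(μ) + E Σ_records e^{μ|v⁺|²} ] = O(1)` for every `μ < 1/(2Θ)` by
`EnvelopeAt` (`X_N(μ) = ∫₀ᵗ (N+1)⁻¹ Σᵢ e^{μ|vᵢ(s)|²} ds`, the crux's functional: the Bochner integral on `Icc 0 t` of a
finite empirical average equals the `lintegral` form on `Φ.good`, conull for `localGibbsLaw ≪ liouville`);
(2) THE DIAL: take `λ` with `2λ(1+ε) < 1/(2Θ)`; then `E Wᵢ^{2+2ε} ≤ t^{1+2ε} E X_N((2+2ε)λ)·(N+1)`-type bounds make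
`Wᵢ = ∫₀ᵗ e^{λ|vᵢ|²}` uniformly integrable in `L²`; (3) truncate `e^{λ|v|²} ∧ L` (a `[0,L]`-valued one-time
observable), apply stub 5 at all `(s, s')` and dominated convergence: `Cov(W₁^{(L)}, W₂^{(L)}) ≤ t² L² δ_N`, tails by UI;
(4) `Var X_N(λ) ≤ (N+1)⁻¹ max Var Wᵢ + max_{i≠j} Cov → 0`, Chebyshev with `C := sup_N E X_N(λ) + 1` gives
`P_N{C < X_N(λ)} → 0`, i.e. `PartIAt` with `lam = λ`, `Cexp = C`. Honours `Negative/AllLambda` (`λ < 1/(4Θ)`, far below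
`1/(2 θ_max)`). -/
theorem stub_occupationLedger :
    ∀ (σ : ℝ) (a₀ θ₀ : T3 → ℝ) (u₀ : T3 → V3) (Φ : Flows σ) (t : ℝ), 0 < σ → σ < 1 / 2 → 0 < t →
      NiceProfiles a₀ θ₀ u₀ →
      EnvelopeAt σ a₀ θ₀ u₀ Φ t → FlightsAndRatesAt σ a₀ θ₀ u₀ Φ t → PairDecorrelationAt σ a₀ θ₀ u₀ Φ t →
        PartIAt σ a₀ θ₀ u₀ Φ t := by
  sorry

/-- STUB 7 — OPEN, NOT THIS IDEA'S LEVER (size L–XL; the output of the (ii)-lines `commutator-matched-bootstrap` /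
`bootstrap-chamber-confinement`, which the lead is advised to skeleton jointly with an (i)-engine: TRIAGE r1-1 "dockings",
r1-2 G1/G3, r1-3 C0/C1/C3). **The dilute chamber holds: component (ii) at `(σ, Φ, t)`.** For continuous positive
profiles there is `σ₀ > 0` such that for `0 < σ < σ₀`, every flow family and every `t > 0`, `PartIIAt σ a₀ θ₀ u₀ Φ t`
(verbatim the crux's second conjunct: `∃ σ₀` and `∃ c₁` kept, so `Negative/WithoutSmallSigma` and
`Negative/BlockDensityAveraging` — `σ₀ ≤ 1`, `c₁ ≤ 1` — are honoured). Why it might fail: a focusing profile passing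
`ρ̄σ³ = 1` before collapse or forming near-vacuum behind the reflected shock (Disproof §5; the (ii)-lines deliver it only
pre-shock and inside the chamber of the comparison solution, r1-3 C1). Sources: Disproof.lean §2–3, §5–6;
Ideas/commutator-matched-bootstrap.md, Ideas/bootstrap-chamber-confinement.md; Spohn1991. -/
theorem stub_chamberImport :
    ∀ (a₀ θ₀ : T3 → ℝ) (u₀ : T3 → V3), NiceProfiles a₀ θ₀ u₀ →
      ∃ σ₀ : ℝ, 0 < σ₀ ∧ ∀ σ : ℝ, 0 < σ → σ < σ₀ → ∀ (Φ : Flows σ) (t : ℝ), 0 < t →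
        PartIIAt σ a₀ θ₀ u₀ Φ t := by
  sorry

end Holds

/-! ## Stub statements by name (D-0027 §3.3: the hypotheses of `AprioriBounds_of` are these `Prop`s) -/

/-- Statement of registered stub 1 (`Holds.stub_pairFactorisation`), by name. -/
def stub_pairFactorisation : Prop := type_of% Holds.stub_pairFactorisation
/-- Statement of registered stub 2 (`Holds.stub_flightsAndRates`), by name. -/
def stub_flightsAndRates : Prop := type_of% Holds.stub_flightsAndRates
/-- Statement of registered stub 3 (`Holds.stub_inputShape`), by name. -/
def stub_inputShape : Prop := type_of% Holds.stub_inputShape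
/-- Statement of registered stub 4 (`Holds.stub_mgfTransport`), by name. -/
def stub_mgfTransport : Prop := type_of% Holds.stub_mgfTransport
/-- Statement of registered stub 5 (`Holds.stub_pairDecorrelation`), by name. -/
def stub_pairDecorrelation : Prop := type_of% Holds.stub_pairDecorrelation
/-- Statement of registered stub 6 (`Holds.stub_occupationLedger`), by name. -/
def stub_occupationLedger : Prop := type_of% Holds.stub_occupationLedger
/-- Statement of registered stub 7 (`Holds.stub_chamberImport`), by name. -/
def stub_chamberImport : Prop := type_of% Holds.stub_chamberImport

/-! ## Composition (sorry-free): the seven stubs ⟹ the crux BY NAME -/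

/-- **The skeleton theorem.** Fix profiles; `σ₀ := min (min (min σ₁ σ₂) (min σ₃ σ₅)) (min σ₇ (1/2))` from the five
profile-level stubs; for `σ < σ₀`, a flow family `Φ` and `t > 0`: stubs 1, 2, 3 feed the transport (stub 4), whose
envelope with stub 2 and stub 5 feeds the occupation ledger (stub 6) — component (i); stub 7 is component (ii); the pair
is the crux's body verbatim (`aprioriBounds_iff` is `Iff.rfl`). -/
theorem AprioriBounds_of
    (h1 : stub_pairFactorisation) (h2 : stub_flightsAndRates) (h3 : stub_inputShape)
    (h4 : stub_mgfTransport) (h5 : stub_pairDecorrelation) (h6 : stub_occupationLedger)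
    (h7 : stub_chamberImport) :
    Summit.AtomisticToContinuum.HydrodynamicLimit.Theses.CollisionIsometryCLT.AprioriBounds := by
  intro a₀ θ₀ u₀ ha hθ hu ha0 hθ0
  have hP : NiceProfiles a₀ θ₀ u₀ := ⟨ha, hθ, hu, ha0, hθ0⟩
  obtain ⟨σ₁, hσ₁, H1⟩ := (h1 : type_of% Holds.stub_pairFactorisation) a₀ θ₀ u₀ hP
  obtain ⟨σ₂, hσ₂, H2⟩ := (h2 : type_of% Holds.stub_flightsAndRates) a₀ θ₀ u₀ hP
  obtain ⟨σ₃, hσ₃, H3⟩ := (h3 : type_of% Holds.stub_inputShape) a₀ θ₀ u₀ hP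
  have H4 := (h4 : type_of% Holds.stub_mgfTransport)
  obtain ⟨σ₅, hσ₅, H5⟩ := (h5 : type_of% Holds.stub_pairDecorrelation) a₀ θ₀ u₀ hP
  have H6 := (h6 : type_of% Holds.stub_occupationLedger)
  obtain ⟨σ₇, hσ₇, H7⟩ := (h7 : type_of% Holds.stub_chamberImport) a₀ θ₀ u₀ hP
  refine ⟨min (min (min σ₁ σ₂) (min σ₃ σ₅)) (min σ₇ (1 / 2)), ?_, ?_⟩
  · exact lt_min (lt_min (lt_min hσ₁ hσ₂) (lt_min hσ₃ hσ₅)) (lt_min hσ₇ (by norm_num))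
  intro σ hσ hlt Φ t ht
  have h1lt : σ < σ₁ :=
    lt_of_lt_of_le hlt (((min_le_left _ _).trans (min_le_left _ _)).trans (min_le_left _ _))
  have h2lt : σ < σ₂ :=
    lt_of_lt_of_le hlt (((min_le_left _ _).trans (min_le_left _ _)).trans (min_le_right _ _))
  have h3lt : σ < σ₃ :=
    lt_of_lt_of_le hlt (((min_le_left _ _).trans (min_le_right _ _)).trans (min_le_left _ _))
  have h5lt : σ < σ₅ :=
    lt_of_lt_of_le hlt (((min_le_left _ _).trans (min_le_right _ _)).trans (min_le_right _ _))
  have h7lt : σ < σ₇ := lt_of_lt_of_le hlt ((min_le_right _ _).trans (min_le_left _ _))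
  have hhalf : σ < 1 / 2 := lt_of_lt_of_le hlt ((min_le_right _ _).trans (min_le_right _ _))
  have hPF : PairFactorisationAt σ a₀ θ₀ u₀ Φ t := H1 σ hσ h1lt Φ t ht
  have hFR : FlightsAndRatesAt σ a₀ θ₀ u₀ Φ t := H2 σ hσ h2lt Φ t ht
  have hIS : InputShapeAt σ a₀ θ₀ u₀ Φ t := H3 σ hσ h3lt Φ t ht
  have hEnv : EnvelopeAt σ a₀ θ₀ u₀ Φ t := H4 σ a₀ θ₀ u₀ Φ t hσ hhalf ht hP hPF hFR hIS
  have hPD : PairDecorrelationAt σ a₀ θ₀ u₀ Φ t := H5 σ hσ h5lt Φ t ht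
  have hI : PartIAt σ a₀ θ₀ u₀ Φ t := H6 σ a₀ θ₀ u₀ Φ t hσ hhalf ht hP hEnv hFR hPD
  have hII : PartIIAt σ a₀ θ₀ u₀ Φ t := H7 σ hσ h7lt Φ t ht
  exact ⟨hI, hII⟩

/-- **The same skeleton for the SHARED copy of the crux** in route `StiffCollisionalRelaxation` (the item
stmt-AtomisticToContinuum-9519 is wanted by both routes; the two decls are syntactically identical, so the proof is
`AprioriBounds_of` by definitional unfolding). This is the unique theorem of the file concluding
`StiffCollisionalRelaxation.AprioriBounds` by name, as `AprioriBounds_of` is for `CollisionIsometryCLT.AprioriBounds`. -/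
theorem AprioriBounds_of_stiff
    (h1 : stub_pairFactorisation) (h2 : stub_flightsAndRates) (h3 : stub_inputShape)
    (h4 : stub_mgfTransport) (h5 : stub_pairDecorrelation) (h6 : stub_occupationLedger)
    (h7 : stub_chamberImport) :
    Summit.AtomisticToContinuum.HydrodynamicLimit.Theses.StiffCollisionalRelaxation.AprioriBounds :=
  AprioriBounds_of h1 h2 h3 h4 h5 h6 h7

/-- D-0027 §3.3 shape: the crux from the registered stubs — an `example`, so that `AprioriBounds_of` stays the unique
theorem concluding the crux; it becomes the proof of the item once the seven `sorry`s are discharged. -/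
example : Summit.AtomisticToContinuum.HydrodynamicLimit.Theses.CollisionIsometryCLT.AprioriBounds :=
  AprioriBounds_of Holds.stub_pairFactorisation Holds.stub_flightsAndRates Holds.stub_inputShape
    Holds.stub_mgfTransport Holds.stub_pairDecorrelation Holds.stub_occupationLedger Holds.stub_chamberImport

/-- The shared copy from the registered stubs (same `example` shape). -/
example : Summit.AtomisticToContinuum.HydrodynamicLimit.Theses.StiffCollisionalRelaxation.AprioriBounds :=
  AprioriBounds_of_stiff Holds.stub_pairFactorisation Holds.stub_flightsAndRates Holds.stub_inputShape
    Holds.stub_mgfTransport Holds.stub_pairDecorrelation Holds.stub_occupationLedger Holds.stub_chamberImport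

end

end Summit.AtomisticToContinuum.HydrodynamicLimit.Cruxes.AprioriBounds.PythagoreanMgfTransport
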